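import Literature.NumberTheory.DiophantineGeometry.AbcWave0
import HarnessLib

/-!
# Baker–Wüstholz (`abc.S24`): Liouville's inequality, reduction to the printed shape, case `n = 1`

Sibling proof file of `AbcWave0.lean` for the named fact
`Literature.NumberTheory.DiophantineGeometry.baker_wustholz` (**abc.S24**; Baker–Wüstholz,
*Logarithmic forms and group varieties*, J. reine angew. Math. **442** (1993), 19–62, Theorem
= Baker–Wüstholz, *Logarithmic Forms and Diophantine Geometry* (2007), Theorem 7.1).
Everything here is **proved**; there are no definitions and no new named facts.

* `inv_mulHeight₁_le_norm_complexEmbedding`, `neg_logHeight₁_le_log_norm_complexEmbedding` — the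
  **archimedean Liouville inequality** for a number field `K`, an embedding `σ : K →+* ℂ` and
  `x ≠ 0`: `‖σ x‖ ≥ H_K(x)⁻¹`, i.e. `log ‖σ x‖ ≥ -logHeight₁ x`, where `H_K = Height.mulHeight₁`
  is Mathlib's (relative) multiplicative height (product formula `NumberField.prod_abs_eq_one`
  against `NumberField.mulHeight₁_eq`). The `p`-adic analogue is
  `Literature.NumberTheory.Transcendental.neg_logHeight₁_le_log_norm_embedding`.
* `half_norm_sub_one_le_norm_log` — `‖z - 1‖ / 2 ≤ ‖log z‖` when `‖log z‖ ≤ 1` (`z ≠ 0`).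
* `bwConstant_one`, `bwConstant_one_ge`, `bwConstant_pos`, `bwConstant_mono_right`,
  `logHeight₁_le_finrank_mul_bwHeight`, `norm_log_le_finrank_mul_bwHeight`,
  `one_le_finrank_mul_bwHeight`, `bwHeight_pos` — bookkeeping for `C(n, d)` and `h'`.
* `bwHeight_one`, `bwConstant_mul_pow_le`, `max_log_div_le_log_exp_mul`,
  `baker_wustholz_of_forall_ne_one` — **reduction to the printed shape inside `K`**: to prove
  `baker_wustholz K` it suffices to treat families with all `αᵢ ≠ 1` (the printed hypothesis
  "not `0` or `1`") and the printed height of the linear form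
  `h'(L) = (1/d) max (h(L), 1) = max (log (B / gcd bᵢ), 1/d)` in place of `log (e B)`; the
  numbers `αᵢ = 1` drop out of `Λ` and cost a factor `h'(1) = 1/d` each, absorbed by
  `C(n', d) d^{n-n'} ≤ C(n, d)`. (The remaining difference with the printed Theorem 7.1 — the
  degree of `ℚ(α₁, …, αₙ)` versus that of the ambient `K` — is the monotonicity in `d` recorded in
  the docstring of `baker_wustholz`; it needs the invariance of the absolute height under field
  extension and is not formalised here.)
* `baker_wustholz_one` — **the case `n = 1` of `baker_wustholz K`, proved**: for `α ≠ 0` in `K`,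
  `b ∈ ℤ` and `Λ = b log σ(α) ≠ 0`, `log |Λ| > -C(1, d) h'(α) log (e |b|)`. Proof (Liouville):
  `Λ ≠ 0` forces `b ≠ 0`, `log σ(α) ≠ 0`, `α ≠ 1`; if `|log σ(α)| ≤ 1` then
  `|log σ(α)| ≥ |σ(α) - 1| / 2 ≥ H_K(α - 1)⁻¹ / 2 ≥ (2^{d+1} H_K(α))⁻¹`
  (`Height.logHeight₁_sub_le`), so in all cases
  `log |Λ| ≥ log |log σ(α)| ≥ -(logHeight₁ α + (d + 1) log 2)` (`logHeight₁ α = d · h(α)`), while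
  `C(1, d) h'(α) log (e|b|) ≥ 589824 · d² · max(logHeight₁ α, 1)`.

The general case (`n ≥ 2`) is the Baker–Wüstholz theorem proper (Kummer descent, generalised
Siegel lemma, multiplicity estimates on `G_a × G_m^r`, Blaschke-product extrapolation;
[BakerWustholz2007, §7.2]) and is not attempted here; `baker_wustholz` stays a cited named fact.

## References

* [BakerWustholz2007] A. Baker, G. Wüstholz, *Logarithmic Forms and Diophantine Geometry*, New
  Mathematical Monographs 9, CUP 2007, doi:10.1017/CBO9780511542862 — Thm 7.1 (PDF pp. 125–126),
  Weil height normalisation (PDF p. 14).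
* [BakerWustholz1993] A. Baker, G. Wüstholz, *Logarithmic forms and group varieties*, J. reine
  angew. Math. 442 (1993), 19–62, doi:10.1515/crll.1993.442.19 (main Theorem, as restated in
  [BakerWustholz2007, Thm 7.1]).
* M. Waldschmidt, *Diophantine Approximation on Linear Algebraic Groups*, Grundlehren 326,
  Springer 2000, §3.5 (Liouville's inequality).
-/

noncomputable section

open NumberField Height Finset

namespace Literature.NumberTheory.DiophantineGeometry

variable {K : Type*} [Field K] [NumberField K]

/-! ### The archimedean Liouville inequality -/

/-- **Archimedean Liouville inequality.** For a number field `K`, an embedding `σ : K →+* ℂ` and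
`x ≠ 0` in `K`: `‖σ x‖ ≥ H_K(x)⁻¹`, where `H_K = Height.mulHeight₁` is the multiplicative height
of `K` (relative normalisation, `log H_K = [K:ℚ] · h`). Proof: in the product formula
`(∏_w |x|_w^{n_w}) · ∏_v |x|_v = 1` bound every factor other than `|x|_{w₀}^{n_{w₀}}`
(`w₀` the place of `σ`) by `max(|x|, 1)`, giving `1 ≤ |x|_{w₀}^{n_{w₀}} H_K(x)`, and
`|x|_{w₀}^{n_{w₀}} ≤ |x|_{w₀}` when `|x|_{w₀} < 1`. [folklore] -/
theorem inv_mulHeight₁_le_norm_complexEmbedding (σ : K →+* ℂ) {x : K} (hx : x ≠ 0) :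
    (mulHeight₁ x)⁻¹ ≤ ‖σ x‖ := by
  classical
  set w₀ : InfinitePlace K := InfinitePlace.mk σ with hw₀def
  have hw₀ : w₀ x = ‖σ x‖ := InfinitePlace.apply σ x
  have hx0 : 0 < w₀ x := by
    rw [hw₀]
    exact norm_pos_iff.mpr ((map_ne_zero σ).mpr hx)
  -- the finite part of the product formula is at most the finite part of the height
  have hfs : (fun v : FinitePlace K ↦ v x).HasFiniteMulSupport := FinitePlace.hasFiniteMulSupport hx
  have hfin : ∏ᶠ v : FinitePlace K, v x ≤ ∏ᶠ v : FinitePlace K, max (v x) 1 :=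
    finprod_le_finprod hfs (fun v ↦ apply_nonneg _ _) (hfs.max Function.hasFiniteMulSupport_one)
      fun v ↦ le_max_left _ _
  -- the infinite part: isolate the place `w₀` of `σ`
  have hinf : ∏ w : InfinitePlace K, w x ^ w.mult ≤
      w₀ x ^ w₀.mult * ∏ w : InfinitePlace K, max (w x) 1 ^ w.mult := by
    rw [← mul_prod_erase univ (fun w : InfinitePlace K ↦ w x ^ w.mult) (mem_univ w₀),
      ← mul_prod_erase univ (fun w : InfinitePlace K ↦ max (w x) 1 ^ w.mult) (mem_univ w₀)]
    have h1 : ∏ w ∈ univ.erase w₀, w x ^ w.mult ≤ ∏ w ∈ univ.erase w₀, max (w x) 1 ^ w.mult :=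
      prod_le_prod (fun w _ ↦ pow_nonneg (apply_nonneg _ _) _) fun w _ ↦
        pow_le_pow_left₀ (apply_nonneg _ _) (le_max_left _ _) _
    have h2 : (0 : ℝ) ≤ ∏ w ∈ univ.erase w₀, max (w x) 1 ^ w.mult :=
      prod_nonneg fun w _ ↦ pow_nonneg ((apply_nonneg _ _).trans (le_max_left _ _)) _
    have h3 : (1 : ℝ) ≤ max (w₀ x) 1 ^ w₀.mult := one_le_pow₀ (le_max_right _ _)
    have h0 : (0 : ℝ) ≤ w₀ x ^ w₀.mult := pow_nonneg (apply_nonneg _ _) _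
    calc w₀ x ^ w₀.mult * ∏ w ∈ univ.erase w₀, w x ^ w.mult
        ≤ w₀ x ^ w₀.mult * ∏ w ∈ univ.erase w₀, max (w x) 1 ^ w.mult :=
          mul_le_mul_of_nonneg_left h1 h0
      _ ≤ w₀ x ^ w₀.mult * (max (w₀ x) 1 ^ w₀.mult * ∏ w ∈ univ.erase w₀, max (w x) 1 ^ w.mult) :=
          mul_le_mul_of_nonneg_left (le_mul_of_one_le_left h2 h3) h0
  -- combine with the product formula `(∏ w, w x ^ mult w) * ∏ᶠ v, v x = 1`
  have hfin0 : (0 : ℝ) ≤ ∏ᶠ v : FinitePlace K, v x := finprod_nonneg fun v ↦ apply_nonneg _ _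
  have hinf0 : (0 : ℝ) ≤ w₀ x ^ w₀.mult * ∏ w : InfinitePlace K, max (w x) 1 ^ w.mult :=
    mul_nonneg (pow_nonneg (apply_nonneg _ _) _)
      (prod_nonneg fun w _ ↦ pow_nonneg ((apply_nonneg _ _).trans (le_max_left _ _)) _)
  have key : (1 : ℝ) ≤ w₀ x ^ w₀.mult * mulHeight₁ x := by
    calc (1 : ℝ) = (∏ w : InfinitePlace K, w x ^ w.mult) * ∏ᶠ v : FinitePlace K, v x :=
          (prod_abs_eq_one hx).symm
      _ ≤ (w₀ x ^ w₀.mult * ∏ w : InfinitePlace K, max (w x) 1 ^ w.mult) *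
            ∏ᶠ v : FinitePlace K, max (v x) 1 :=
          mul_le_mul hinf hfin hfin0 hinf0
      _ = w₀ x ^ w₀.mult * mulHeight₁ x := by rw [NumberField.mulHeight₁_eq]; ring
  -- conclude
  rw [← hw₀]
  have hH0 : 0 < mulHeight₁ x := mulHeight₁_pos x
  rcases le_or_gt 1 (w₀ x) with h1 | h1
  · exact (inv_le_one_of_one_le₀ (one_le_mulHeight₁ x)).trans h1
  · have hpow : w₀ x ^ w₀.mult ≤ w₀ x :=
      pow_le_of_le_one (apply_nonneg _ _) h1.le InfinitePlace.mult_ne_zero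
    rw [inv_le_iff_one_le_mul₀' hH0]
    calc (1 : ℝ) ≤ w₀ x ^ w₀.mult * mulHeight₁ x := key
      _ ≤ w₀ x * mulHeight₁ x := mul_le_mul_of_nonneg_right hpow hH0.le
      _ = mulHeight₁ x * w₀ x := mul_comm _ _

/-- **Archimedean Liouville inequality, logarithmic form**: `log ‖σ x‖ ≥ -logHeight₁ x` for
`x ≠ 0` in a number field `K` and `σ : K →+* ℂ` (`logHeight₁ = log H_K = [K:ℚ] · h`). [folklore] -/
theorem neg_logHeight₁_le_log_norm_complexEmbedding (σ : K →+* ℂ) {x : K} (hx : x ≠ 0) :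
    -logHeight₁ x ≤ Real.log ‖σ x‖ := by
  have h := inv_mulHeight₁_le_norm_complexEmbedding σ hx
  rw [logHeight₁_eq_log_mulHeight₁, ← Real.log_inv]
  exact Real.log_le_log (inv_pos.mpr (mulHeight₁_pos x)) h

/-! ### The principal logarithm near `1` -/

/-- For `z ≠ 0` with `‖log z‖ ≤ 1` (principal logarithm): `‖z - 1‖ / 2 ≤ ‖log z‖`, from
`‖e^w - 1‖ ≤ 2‖w‖` for `‖w‖ ≤ 1` (`Complex.norm_exp_sub_one_le`) with `w = log z`. [folklore] -/
theorem half_norm_sub_one_le_norm_log {z : ℂ} (hz : z ≠ 0) (h : ‖Complex.log z‖ ≤ 1) :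
    ‖z - 1‖ / 2 ≤ ‖Complex.log z‖ := by
  have := Complex.norm_exp_sub_one_le h
  rw [Complex.exp_log hz] at this
  linarith

/-! ### Bookkeeping for `C(1, d)` and `h'` -/

/-- `C(1, d) = 18 · 2! · 1² · (32 d)³ · log (2d) = 1179648 · d³ · log (2d)`. [folklore] -/
theorem bwConstant_one (d : ℕ) :
    bwConstant 1 d = 1179648 * (d : ℝ) ^ 3 * Real.log (2 * d) := by
  unfold bwConstant
  simp only [Nat.factorial, Nat.cast_one, mul_one, one_pow, Nat.cast_ofNat, Nat.succ_eq_add_one,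
    Nat.reduceAdd]
  ring

/-- `C(1, d) ≥ 589824 · d³` for `d ≥ 1` (as `log (2d) ≥ log 2 > 1/2`). [folklore] -/
theorem bwConstant_one_ge {d : ℕ} (hd : 1 ≤ d) :
    589824 * (d : ℝ) ^ 3 ≤ bwConstant 1 d := by
  rw [bwConstant_one]
  have hd' : (1 : ℝ) ≤ d := by exact_mod_cast hd
  have hlog : 1 / 2 ≤ Real.log (2 * d) := by
    have h2 : Real.log 2 ≤ Real.log (2 * d) :=
      Real.log_le_log two_pos (by linarith)
    linarith [Real.log_two_gt_d9]
  have hd3 : (0 : ℝ) ≤ (d : ℝ) ^ 3 := by positivity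
  nlinarith

/-- `d · h'(α) ≥ logHeight₁ α` (`d = [K:ℚ]`; `h'` is `bwHeight`). [folklore] -/
theorem logHeight₁_le_finrank_mul_bwHeight (σ : K →+* ℂ) (α : K) :
    logHeight₁ α ≤ (Module.finrank ℚ K : ℝ) * bwHeight σ α := by
  have hd : (0 : ℝ) < Module.finrank ℚ K := by exact_mod_cast Module.finrank_pos
  have h : logHeight₁ α / (Module.finrank ℚ K : ℝ) ≤ bwHeight σ α := le_max_left _ _
  rwa [div_le_iff₀' hd] at h

/-- `d · h'(α) ≥ ‖log σ(α)‖`. [folklore] -/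
theorem norm_log_le_finrank_mul_bwHeight (σ : K →+* ℂ) (α : K) :
    ‖Complex.log (σ α)‖ ≤ (Module.finrank ℚ K : ℝ) * bwHeight σ α := by
  have hd : (0 : ℝ) < Module.finrank ℚ K := by exact_mod_cast Module.finrank_pos
  have h : ‖Complex.log (σ α)‖ / (Module.finrank ℚ K : ℝ) ≤ bwHeight σ α :=
    (le_max_left _ _).trans (le_max_right _ _)
  rwa [div_le_iff₀' hd] at h

/-- `d · h'(α) ≥ 1`. [folklore] -/
theorem one_le_finrank_mul_bwHeight (σ : K →+* ℂ) (α : K) :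
    1 ≤ (Module.finrank ℚ K : ℝ) * bwHeight σ α := by
  have hd : (0 : ℝ) < Module.finrank ℚ K := by exact_mod_cast Module.finrank_pos
  have h : 1 / (Module.finrank ℚ K : ℝ) ≤ bwHeight σ α :=
    (le_max_right _ _).trans (le_max_right _ _)
  rwa [div_le_iff₀' hd] at h

/-- `h'(α) > 0`. [folklore] -/
theorem bwHeight_pos (σ : K →+* ℂ) (α : K) : 0 < bwHeight σ α := by
  have hd : (0 : ℝ) < Module.finrank ℚ K := by exact_mod_cast Module.finrank_pos
  exact lt_of_lt_of_le (by positivity) ((le_max_right _ _).trans (le_max_right _ _))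

/-- `C(n, d) > 0` for `n, d ≥ 1`. [folklore] -/
theorem bwConstant_pos {n d : ℕ} (hn : 1 ≤ n) (hd : 1 ≤ d) : 0 < bwConstant n d := by
  unfold bwConstant
  have hn' : (1 : ℝ) ≤ n := by exact_mod_cast hn
  have hd' : (1 : ℝ) ≤ d := by exact_mod_cast hd
  have hlog : 0 < Real.log (2 * n * d) := Real.log_pos (by nlinarith)
  positivity

/-- `C(n, d)` is monotone in the degree: `C(n, d) ≤ C(n, d')` for `1 ≤ d ≤ d'` (`n ≥ 1`); this is
the numerical half of the remark that the bound of `baker_wustholz` weakens when the field `K` is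
enlarged. [folklore] -/
theorem bwConstant_mono_right {n d d' : ℕ} (hn : 1 ≤ n) (hd : 1 ≤ d) (hdd' : d ≤ d') :
    bwConstant n d ≤ bwConstant n d' := by
  unfold bwConstant
  have hn' : (1 : ℝ) ≤ n := by exact_mod_cast hn
  have hd1 : (1 : ℝ) ≤ d := by exact_mod_cast hd
  have hdd : (d : ℝ) ≤ d' := by exact_mod_cast hdd'
  have hlog0 : 0 < Real.log (2 * n * d) := Real.log_pos (by nlinarith)
  have hlog : Real.log (2 * n * d) ≤ Real.log (2 * n * d') :=
    Real.log_le_log (by nlinarith) (by nlinarith)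
  have hpow : (32 * (d : ℝ)) ^ (n + 2) ≤ (32 * (d' : ℝ)) ^ (n + 2) :=
    pow_le_pow_left₀ (by positivity) (by linarith) _
  have hA : (0 : ℝ) ≤ 18 * (Nat.factorial (n + 1) : ℝ) * (n : ℝ) ^ (n + 1) := by positivity
  calc 18 * (Nat.factorial (n + 1) : ℝ) * (n : ℝ) ^ (n + 1) * (32 * (d : ℝ)) ^ (n + 2) *
        Real.log (2 * n * d)
      ≤ 18 * (Nat.factorial (n + 1) : ℝ) * (n : ℝ) ^ (n + 1) * (32 * (d' : ℝ)) ^ (n + 2) *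
        Real.log (2 * n * d) :=
        mul_le_mul_of_nonneg_right (mul_le_mul_of_nonneg_left hpow hA) hlog0.le
    _ ≤ 18 * (Nat.factorial (n + 1) : ℝ) * (n : ℝ) ^ (n + 1) * (32 * (d' : ℝ)) ^ (n + 2) *
        Real.log (2 * n * d') :=
        mul_le_mul_of_nonneg_left hlog (mul_nonneg hA (by positivity))

/-! ### Reduction of the vendored statement to the printed shape (inside `K`) -/

/-- `h'(1) = 1/d`: the modified height of `1` (principal `log 1 = 0`, `logHeight₁ 1 = 0`).
[folklore] -/
theorem bwHeight_one (σ : K →+* ℂ) : bwHeight σ (1 : K) = 1 / (Module.finrank ℚ K : ℝ) := by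
  have hD : (0 : ℝ) ≤ 1 / (Module.finrank ℚ K : ℝ) := by positivity
  unfold bwHeight
  rw [map_one, Complex.log_one, norm_zero, logHeight₁_one, zero_div, max_eq_right hD,
    max_eq_right hD]

/-- `C(n', d) · d^{n-n'} ≤ C(n, d)` for `1 ≤ n' ≤ n`, `d ≥ 1`: dropping `n - n'` numbers `αᵢ = 1`
(each with `h'(1) = 1/d`) from a linear form only weakens the Baker–Wüstholz bound. [folklore] -/
theorem bwConstant_mul_pow_le {n' n d : ℕ} (hn' : 1 ≤ n') (hn : n' ≤ n) (hd : 1 ≤ d) :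
    bwConstant n' d * (d : ℝ) ^ (n - n') ≤ bwConstant n d := by
  obtain ⟨m, rfl⟩ := Nat.exists_eq_add_of_le hn
  rw [Nat.add_sub_cancel_left]
  unfold bwConstant
  have hn1 : (1 : ℝ) ≤ n' := by exact_mod_cast hn'
  have hd1 : (1 : ℝ) ≤ d := by exact_mod_cast hd
  have hm0 : (0 : ℝ) ≤ m := by positivity
  have hcast : ((n' + m : ℕ) : ℝ) = (n' : ℝ) + m := by push_cast; ring
  -- factor inequalities
  have f1 : ((Nat.factorial (n' + 1) : ℕ) : ℝ) ≤ ((Nat.factorial (n' + m + 1) : ℕ) : ℝ) := by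
    exact_mod_cast Nat.factorial_le (by omega)
  have f2 : (n' : ℝ) ^ (n' + 1) ≤ ((n' + m : ℕ) : ℝ) ^ (n' + m + 1) := by
    rw [hcast]
    calc (n' : ℝ) ^ (n' + 1) ≤ ((n' : ℝ) + m) ^ (n' + 1) :=
          pow_le_pow_left₀ (by positivity) (by linarith) _
      _ ≤ ((n' : ℝ) + m) ^ (n' + m + 1) := pow_le_pow_right₀ (by linarith) (by omega)
  have f3 : (32 * (d : ℝ)) ^ (n' + 2) * (d : ℝ) ^ m ≤ (32 * (d : ℝ)) ^ (n' + m + 2) := by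
    have : (32 * (d : ℝ)) ^ (n' + m + 2) = (32 * (d : ℝ)) ^ (n' + 2) * (32 * (d : ℝ)) ^ m := by
      rw [← pow_add]; ring_nf
    rw [this]
    exact mul_le_mul_of_nonneg_left (pow_le_pow_left₀ (by positivity) (by linarith) _)
      (by positivity)
  have f4 : Real.log (2 * n' * d) ≤ Real.log (2 * ((n' + m : ℕ) : ℝ) * d) := by
    rw [hcast]
    exact Real.log_le_log (by positivity) (by nlinarith)
  have hlog0 : 0 ≤ Real.log (2 * n' * d) := Real.log_nonneg (by nlinarith)
  have hA0 : (0 : ℝ) ≤ 18 * ((Nat.factorial (n' + m + 1) : ℕ) : ℝ) * ((n' + m : ℕ) : ℝ) ^ (n' + m + 1) := by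
    positivity
  calc 18 * ((Nat.factorial (n' + 1) : ℕ) : ℝ) * (n' : ℝ) ^ (n' + 1) * (32 * (d : ℝ)) ^ (n' + 2) *
        Real.log (2 * n' * d) * (d : ℝ) ^ m
      = (18 * ((Nat.factorial (n' + 1) : ℕ) : ℝ) * (n' : ℝ) ^ (n' + 1)) *
          ((32 * (d : ℝ)) ^ (n' + 2) * (d : ℝ) ^ m) * Real.log (2 * n' * d) := by ring
    _ ≤ (18 * ((Nat.factorial (n' + m + 1) : ℕ) : ℝ) * ((n' + m : ℕ) : ℝ) ^ (n' + m + 1)) *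
          (32 * (d : ℝ)) ^ (n' + m + 2) * Real.log (2 * ((n' + m : ℕ) : ℝ) * d) := by
        apply mul_le_mul _ f4 hlog0 (mul_nonneg hA0 (by positivity))
        apply mul_le_mul _ f3 (by positivity) hA0
        exact mul_le_mul (mul_le_mul_of_nonneg_left f1 (by norm_num)) f2 (by positivity)
          (by positivity)
    _ = 18 * ((Nat.factorial (n' + m + 1) : ℕ) : ℝ) * ((n' + m : ℕ) : ℝ) ^ (n' + m + 1) *
          (32 * (d : ℝ)) ^ (n' + m + 2) * Real.log (2 * ((n' + m : ℕ) : ℝ) * d) := by ring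

/-- `h'(L) ≤ log (e B)`: with `B = max |bᵢ| ≥ 1`, `b = gcd (bᵢ)` and `d ≥ 1`,
`max (log (B / b), 1/d) ≤ 1 + log B`. [folklore] -/
theorem max_log_div_le_log_exp_mul {B g d : ℕ} (hB : 1 ≤ B) (hd : 1 ≤ d) :
    max (Real.log ((B : ℝ) / g)) (1 / (d : ℝ)) ≤ Real.log (Real.exp 1 * B) := by
  have hB' : (1 : ℝ) ≤ B := by exact_mod_cast hB
  have hd' : (1 : ℝ) ≤ d := by exact_mod_cast hd
  have hlog : Real.log (Real.exp 1 * B) = 1 + Real.log B := by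
    rw [Real.log_mul (Real.exp_pos 1).ne' (by positivity), Real.log_exp]
  have hlogB : 0 ≤ Real.log B := Real.log_nonneg hB'
  rw [hlog]
  refine max_le ?_ ?_
  · rcases Nat.eq_zero_or_pos g with rfl | hg
    · simp only [Nat.cast_zero, div_zero, Real.log_zero]
      linarith
    · have hg' : (1 : ℝ) ≤ g := by exact_mod_cast hg
      have h1 : Real.log ((B : ℝ) / g) ≤ Real.log B :=
        Real.log_le_log (by positivity) (div_le_self (by positivity) hg')
      linarith
  · have : 1 / (d : ℝ) ≤ 1 := by
      rw [div_le_one (by positivity)]; exact hd'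
    linarith

/-- **Reduction to the printed shape (within `K`).** To prove `baker_wustholz K` it suffices to
prove it for families with all `αᵢ ≠ 1` (Baker–Wüstholz's hypothesis "not `0` or `1`") and with
the printed height of the linear form `h'(L) = (1/d) max (h(L), 1) = max (log (B/b), 1/d)`
(`b = gcd bᵢ`) in place of `log (e B)`: numbers `αᵢ = 1` contribute nothing to `Λ`
(`log 1 = 0`) and a factor `h'(1) = 1/d` each to the product, and
`C(n', d) d^{n-n'} ≤ C(n, d)` (`bwConstant_mul_pow_le`), while `h'(L) ≤ log (e B)`
(`max_log_div_le_log_exp_mul`). This is the part of the comparison "printed Theorem 7.1 ⟹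
`baker_wustholz`" that takes place inside the fixed field `K`.
[cite: BakerWustholz2007, Thm 7.1 (hypotheses and h'(L), PDF pp. 125–126)] -/
theorem baker_wustholz_of_forall_ne_one
    (h : ∀ (σ : K →+* ℂ) {n : ℕ} (α : Fin n → K) (b : Fin n → ℤ),
      (∀ i, α i ≠ 0) → (∀ i, α i ≠ 1) → ∑ i, (b i : ℂ) * Complex.log (σ (α i)) ≠ 0 →
      -(bwConstant n (Module.finrank ℚ K) * (∏ i, bwHeight σ (α i)) *
          max (Real.log (((Finset.univ.sup fun i ↦ (b i).natAbs : ℕ) : ℝ) /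
                ((Finset.univ.gcd fun i ↦ (b i).natAbs : ℕ) : ℝ)))
            (1 / (Module.finrank ℚ K : ℝ))) <
        Real.log ‖∑ i, (b i : ℂ) * Complex.log (σ (α i))‖) :
    baker_wustholz K := by
  intro σ n α b hα hΛ
  classical
  set D : ℕ := Module.finrank ℚ K with hDdef
  have hD1 : 1 ≤ D := Module.finrank_pos
  have hD0 : (0 : ℝ) < D := by exact_mod_cast hD1
  -- the subfamily of the `α i ≠ 1`
  set S : Finset (Fin n) := Finset.univ.filter fun i ↦ α i ≠ 1 with hSdef
  set n' : ℕ := S.card with hn'def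
  set e : Fin n' ≃ S := S.equivFin.symm with hedef
  set α' : Fin n' → K := fun j ↦ α (e j) with hα'def
  set b' : Fin n' → ℤ := fun j ↦ b (e j) with hb'def
  have hα'0 : ∀ j, α' j ≠ 0 := fun j ↦ hα _
  have hα'1 : ∀ j, α' j ≠ 1 := fun j ↦ (Finset.mem_filter.mp (e j).2).2
  -- the linear form is unchanged
  set f : Fin n → ℂ := fun i ↦ (b i : ℂ) * Complex.log (σ (α i)) with hfdef
  have hterm0 : ∀ i, i ∉ S → f i = 0 := by
    intro i hi
    have h1 : α i = 1 := by
      by_contra hne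
      exact hi (Finset.mem_filter.mpr ⟨Finset.mem_univ _, hne⟩)
    simp [hfdef, h1]
  have hsumS : ∑ i, f i = ∑ i ∈ S, f i :=
    (Finset.sum_subset (Finset.subset_univ S) (fun i _ hi ↦ hterm0 i hi)).symm
  have hΛeq : ∑ j, (b' j : ℂ) * Complex.log (σ (α' j)) = ∑ i, f i := by
    rw [hsumS, ← Finset.sum_coe_sort S]
    exact Equiv.sum_comp e (fun x : S ↦ f x)
  have hΛ' : ∑ j, (b' j : ℂ) * Complex.log (σ (α' j)) ≠ 0 := by rw [hΛeq]; exact hΛ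
  -- apply the hypothesis to the subfamily
  have key := h σ α' b' hα'0 hα'1 hΛ'
  rw [hΛeq] at key
  refine lt_of_le_of_lt (neg_le_neg ?_) key
  -- notation for the two bounds
  set B : ℕ := Finset.univ.sup fun i ↦ (b i).natAbs with hBdef
  set B' : ℕ := Finset.univ.sup fun j ↦ (b' j).natAbs with hB'def
  set g' : ℕ := Finset.univ.gcd fun j ↦ (b' j).natAbs with hg'def
  set P : ℝ := ∏ i, bwHeight σ (α i) with hPdef
  set P' : ℝ := ∏ j, bwHeight σ (α' j) with hP'def
  -- `n' ≥ 1` and `B' ≥ 1` (the subfamily carries the nonzero form), `B' ≤ B`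
  have hn'1 : 1 ≤ n' := by
    by_contra hlt
    have h0 : n' = 0 := by omega
    apply hΛ'
    have : IsEmpty (Fin n') := by rw [h0]; exact Fin.isEmpty'
    exact Fintype.sum_empty _
  have hB'1 : 1 ≤ B' := by
    by_contra hlt
    have hB'0 : B' = 0 := by omega
    apply hΛ'
    refine Finset.sum_eq_zero fun j _ ↦ ?_
    have hj : (b' j).natAbs ≤ B' :=
      Finset.le_sup (f := fun j ↦ (b' j).natAbs) (Finset.mem_univ j)
    have hj0 : b' j = 0 := by
      rw [hB'0, Nat.le_zero] at hj
      exact Int.natAbs_eq_zero.mp hj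
    simp [hj0]
  have hB'B : B' ≤ B :=
    Finset.sup_le fun j _ ↦
      Finset.le_sup (f := fun i ↦ (b i).natAbs) (Finset.mem_univ (e j : Fin n))
  -- (i) `h'(L') ≤ log (e B') ≤ log (e B)`
  have hL' : max (Real.log ((B' : ℝ) / g')) (1 / (D : ℝ)) ≤ Real.log (Real.exp 1 * B) := by
    refine (max_log_div_le_log_exp_mul hB'1 hD1).trans ?_
    have h1 : (1 : ℝ) ≤ B' := by exact_mod_cast hB'1
    have h2 : (B' : ℝ) ≤ B := by exact_mod_cast hB'B
    exact Real.log_le_log (by positivity) (mul_le_mul_of_nonneg_left h2 (Real.exp_pos 1).le)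
  -- (ii) the product of modified heights: `P = P' · (1/D)^(n - n')`
  have hPeq : P = P' * (1 / (D : ℝ)) ^ (n - n') := by
    have hsplit := Finset.prod_filter_mul_prod_filter_not (Finset.univ : Finset (Fin n))
      (fun i ↦ α i ≠ 1) (fun i ↦ bwHeight σ (α i))
    have h1 : ∏ i ∈ S, bwHeight σ (α i) = P' := by
      rw [hP'def, ← Finset.prod_coe_sort S]
      exact (Equiv.prod_comp e (fun x : S ↦ bwHeight σ (α x))).symm
    have h2' : ∀ i ∈ Finset.univ.filter (fun i ↦ ¬ (α i ≠ 1)),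
        bwHeight σ (α i) = 1 / (D : ℝ) := by
      intro i hi
      have : α i = 1 := by simpa using (Finset.mem_filter.mp hi).2
      rw [this, bwHeight_one]
    have hcard : (Finset.univ.filter (fun i ↦ ¬ (α i ≠ 1))).card = n - n' := by
      have hc := Finset.card_filter_add_card_filter_not
        (s := (Finset.univ : Finset (Fin n))) (fun i ↦ α i ≠ 1)
      rw [Finset.card_univ, Fintype.card_fin, ← hSdef, ← hn'def] at hc
      omega
    have h2 : ∏ i ∈ Finset.univ.filter (fun i ↦ ¬ (α i ≠ 1)), bwHeight σ (α i) =
        (1 / (D : ℝ)) ^ (n - n') := by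
      rw [Finset.prod_eq_pow_card h2', hcard]
    rw [hPdef, ← hsplit, h1, h2]
  -- (iii) the constants: `C(n', D) ≤ C(n, D) (1/D)^(n - n')`
  have hC : bwConstant n' D ≤ bwConstant n D * (1 / (D : ℝ)) ^ (n - n') := by
    have hSn : n' ≤ n := by
      have := Finset.card_le_univ S
      simpa using this
    have h1 := bwConstant_mul_pow_le hn'1 hSn hD1
    have hpow : (0 : ℝ) < (D : ℝ) ^ (n - n') := by positivity
    rw [one_div, inv_pow, ← div_eq_mul_inv, le_div_iff₀ hpow]
    exact h1
  -- assemble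
  have hP'0 : 0 ≤ P' := Finset.prod_nonneg fun j _ ↦ (bwHeight_pos σ (α' j)).le
  have hC'0 : 0 ≤ bwConstant n' D := (bwConstant_pos hn'1 hD1).le
  have hLpos : 0 ≤ max (Real.log ((B' : ℝ) / g')) (1 / (D : ℝ)) :=
    le_max_of_le_right (by positivity)
  calc bwConstant n' D * P' * max (Real.log ((B' : ℝ) / g')) (1 / (D : ℝ))
      ≤ bwConstant n' D * P' * Real.log (Real.exp 1 * B) :=
        mul_le_mul_of_nonneg_left hL' (mul_nonneg hC'0 hP'0)
    _ ≤ (bwConstant n D * (1 / (D : ℝ)) ^ (n - n')) * P' * Real.log (Real.exp 1 * B) :=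
        mul_le_mul_of_nonneg_right (mul_le_mul_of_nonneg_right hC hP'0) (hLpos.trans hL')
    _ = bwConstant n D * P * Real.log (Real.exp 1 * B) := by rw [hPeq]; ring

/-! ### The case `n = 1` -/

/-- **Baker–Wüstholz for one logarithm** (the case `n = 1` of `baker_wustholz K`, proved by
Liouville's inequality): for `α ≠ 0` in the number field `K`, `σ : K →+* ℂ`, `b ∈ ℤ` with
`Λ = b · log σ(α) ≠ 0` (principal logarithm),
`log |Λ| > -C(1, d) h'(α) log (e |b|)`, `d = [K:ℚ]`, in the exact shape of `baker_wustholz`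
(families indexed by `Fin 1`). [cite: BakerWustholz2007, Thm 7.1 (case n = 1)] -/
theorem baker_wustholz_one (σ : K →+* ℂ) (α : Fin 1 → K) (b : Fin 1 → ℤ) (hα : ∀ i, α i ≠ 0)
    (hΛ : ∑ i, (b i : ℂ) * Complex.log (σ (α i)) ≠ 0) :
    -(bwConstant 1 (Module.finrank ℚ K) * (∏ i, bwHeight σ (α i)) *
        Real.log (Real.exp 1 * (Finset.univ.sup fun i ↦ (b i).natAbs : ℕ))) <
      Real.log ‖∑ i, (b i : ℂ) * Complex.log (σ (α i))‖ := by
  -- the data: one logarithm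
  have hB1 : 1 ≤ (Finset.univ.sup fun i ↦ (b i).natAbs : ℕ) := by
    rw [Fin.sum_univ_one] at hΛ
    have hb0 : b 0 ≠ 0 := by
      rintro h
      exact hΛ (by simp [h])
    exact le_trans (Int.natAbs_pos.mpr hb0)
      (Finset.le_sup (f := fun i ↦ (b i).natAbs) (Finset.mem_univ 0))
  set B : ℕ := Finset.univ.sup fun i ↦ (b i).natAbs with hBdef
  rw [Fin.sum_univ_one] at hΛ ⊢
  rw [Fin.prod_univ_one]
  set a : K := α 0 with hadef
  set β : ℤ := b 0 with hβdef
  set w : ℂ := Complex.log (σ a) with hwdef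
  set dn : ℕ := Module.finrank ℚ K with hdndef
  obtain ⟨hβC, hw0⟩ := mul_ne_zero_iff.mp hΛ
  have hz0 : σ a ≠ 0 := (map_ne_zero σ).mpr (hα 0)
  have ha1 : a - 1 ≠ 0 := by
    intro h
    apply hw0
    rw [hwdef, sub_eq_zero.mp h, map_one, Complex.log_one]
  -- reals in play
  set d : ℝ := (dn : ℝ) with hddef
  set hK : ℝ := logHeight₁ a with hhKdef
  set t : ℝ := ‖w‖ with htdef
  have hd1 : (1 : ℝ) ≤ d := by
    have : 1 ≤ dn := Module.finrank_pos
    show (1 : ℝ) ≤ (dn : ℝ)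
    exact_mod_cast this
  have hK0 : 0 ≤ hK := zero_le_logHeight₁ a
  have ht0 : 0 < t := norm_pos_iff.mpr hw0
  -- Step 1 (Liouville): `log t ≥ -(hK + (d + 1) log 2)`
  have hlogt : -(hK + (d + 1) * Real.log 2) ≤ Real.log t := by
    rcases le_or_gt t 1 with ht1 | ht1
    · -- `t ≥ ‖σ a - 1‖ / 2 = ‖σ (a - 1)‖ / 2 ≥ H_K(a-1)⁻¹ / 2`
      have h1 : ‖σ a - 1‖ / 2 ≤ t := half_norm_sub_one_le_norm_log hz0 ht1
      have h2 : ‖σ (a - 1)‖ = ‖σ a - 1‖ := by rw [map_sub, map_one]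
      have h3 : -logHeight₁ (a - 1) ≤ Real.log ‖σ (a - 1)‖ :=
        neg_logHeight₁_le_log_norm_complexEmbedding σ ha1
      have h4 : logHeight₁ (a - 1) ≤ d * Real.log 2 + hK := by
        have := logHeight₁_sub_le a (1 : K)
        rw [logHeight₁_one, add_zero, NumberField.totalWeight_eq_finrank] at this
        simpa [hddef, hdndef] using this
      have h5 : 0 < ‖σ (a - 1)‖ := norm_pos_iff.mpr ((map_ne_zero σ).mpr ha1)
      have h6 : Real.log (‖σ (a - 1)‖ / 2) ≤ Real.log t :=
        Real.log_le_log (by positivity) (by rw [h2]; exact h1)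
      rw [Real.log_div h5.ne' two_ne_zero] at h6
      linarith
    · have : 0 ≤ Real.log t := Real.log_nonneg ht1.le
      have : 0 ≤ (d + 1) * Real.log 2 := by positivity
      linarith
  -- Step 2: `log ‖β w‖ ≥ log t`
  have hΛt : Real.log t ≤ Real.log ‖(β : ℂ) * w‖ := by
    rw [norm_mul, Complex.norm_intCast]
    refine Real.log_le_log ht0 (le_mul_of_one_le_left ht0.le ?_)
    have hβ0 : β ≠ 0 := by exact_mod_cast hβC
    exact_mod_cast Int.one_le_abs hβ0
  -- Step 3: the constant dominates: `C(1,d) h'(a) log(e B) > hK + (d+1) log 2`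
  have hX1 : 1 ≤ d * bwHeight σ a := one_le_finrank_mul_bwHeight σ a
  have hXh : hK ≤ d * bwHeight σ a := logHeight₁_le_finrank_mul_bwHeight σ a
  have hh0 : 0 < bwHeight σ a := bwHeight_pos σ a
  have hC : 589824 * d ^ 3 ≤ bwConstant 1 dn := bwConstant_one_ge Module.finrank_pos
  have hlogB : 1 ≤ Real.log (Real.exp 1 * (B : ℝ)) := by
    have hB1' : (1 : ℝ) ≤ B := by exact_mod_cast hB1
    have : Real.exp 1 ≤ Real.exp 1 * B := le_mul_of_one_le_right (Real.exp_pos 1).le hB1'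
    calc (1 : ℝ) = Real.log (Real.exp 1) := (Real.log_exp 1).symm
      _ ≤ Real.log (Real.exp 1 * B) := Real.log_le_log (Real.exp_pos 1) this
  have hmain : hK + (d + 1) * Real.log 2 < bwConstant 1 dn * bwHeight σ a := by
    set X : ℝ := d * bwHeight σ a with hXdef
    have hX0 : 0 ≤ X := zero_le_one.trans hX1
    have hd2 : 1 ≤ d ^ 2 := by nlinarith
    have e0 : 589824 * (d ^ 2 * X) ≤ bwConstant 1 dn * bwHeight σ a := by
      have : 589824 * (d ^ 2 * X) = 589824 * d ^ 3 * bwHeight σ a := by rw [hXdef]; ring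
      rw [this]
      exact mul_le_mul_of_nonneg_right hC hh0.le
    have e1 : d ≤ d ^ 2 * X := by nlinarith
    have e2 : hK ≤ d ^ 2 * X := (le_mul_of_one_le_left hX0 hd2).trans' hXh
    have e3 : (d + 1) * Real.log 2 ≤ d + 1 := by
      have := Real.log_two_lt_d9
      exact mul_le_of_le_one_right (by linarith) (by linarith)
    linarith
  have hfinal : hK + (d + 1) * Real.log 2 <
      bwConstant 1 dn * bwHeight σ a * Real.log (Real.exp 1 * (B : ℝ)) := by
    have hpos : 0 ≤ bwConstant 1 dn * bwHeight σ a := by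
      have : (0 : ℝ) ≤ 589824 * d ^ 3 := by positivity
      exact mul_nonneg (this.trans hC) hh0.le
    calc hK + (d + 1) * Real.log 2 < bwConstant 1 dn * bwHeight σ a := hmain
      _ = bwConstant 1 dn * bwHeight σ a * 1 := (mul_one _).symm
      _ ≤ bwConstant 1 dn * bwHeight σ a * Real.log (Real.exp 1 * (B : ℝ)) :=
          mul_le_mul_of_nonneg_left hlogB hpos
  linarith

end Literature.NumberTheory.DiophantineGeometry

end
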